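import Mathlib

/-!
# Pólya's theorem on forms positive on the simplex, with the Powers–Reznick bound,
# and Handelman's theorem (simplex, unit cube, generators summing to one)

Let `𝕜` be a linearly ordered field, `f ∈ 𝕜[x₁, …, xₙ]` a form (homogeneous polynomial) of
degree `d`, and `Δ = {x | xᵢ ≥ 0, ∑ xᵢ = 1}` the standard simplex (`stdSimplex 𝕜 ι`).

* `polya_powersReznick` — the effective form [cite: PowersReznick2001, Thm 1]: write
  `f = ∑_{|α| = d} a_α x^α` and suppose `|a_α| ≤ L · d!/(α₁! ⋯ αₙ!)` for all `α` and
  `f ≥ λ` on `Δ`. If `(N + d) · λ > d(d-1)/2 · L` (equivalently `N > d(d-1)/2 · L/λ - d`), then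
  every monomial of degree `N + d` has a strictly positive coefficient in `(x₁ + ⋯ + xₙ)^N · f`.
  The proof is the grid-point argument of Pólya / Powers–Reznick: for `|β| = N + d`,
  `β! · [x^β] ((∑ xᵢ)^N f) = N! · ∑_α a_α · ∏ᵢ βᵢ(βᵢ - 1)⋯(βᵢ - αᵢ + 1)`
  (`prod_factorial_mul_coeff_sum_X_pow_mul`); the falling factorials are compared with the powers
  `∏ᵢ βᵢ^{αᵢ}`, whose weighted sum is `(N+d)^d · f(β/(N+d)) ≥ (N+d)^d · λ`, the total defect being
  controlled by the identities `∑_{|α|=d} c(α) β^{(α)} = (N+d)(N+d-1)⋯(N+1)`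
  (`sum_coeff_sum_X_pow_mul_descFactorial_prod`) and `∑_{|α|=d} c(α) β^α = (N+d)^d` and the
  elementary bound `M^d - M(M-1)⋯(M-d+1) ≤ d(d-1)/2 · M^{d-1}`
  (`pow_succ_le_descFactorial_add_choose_mul_pow`).
* `polya` — Pólya's theorem (1928) [cite: Polya1928, Satz]
  [cite: HardyLittlewoodPolya1952, Thm 56 (§2.24)]: over `ℝ`, if the form `f` is strictly positive
  on `Δ`, then for all sufficiently large `N` every monomial of degree `N + deg f` has a strictly
  positive coefficient in `(x₁ + ⋯ + xₙ)^N · f` (from the effective form, by compactness of `Δ`).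
* The (easy) converse, i.e. soundness of such certificates of positivity:
  `eval_sum_X_pow_mul_of_sum_eq_one` (`((∑ xᵢ)^N f)(x) = f(x)` on `Δ`),
  `eval_nonneg_of_coeff_nonneg`, `eval_pos_of_coeff_pos_of_mem_stdSimplex`, and
  `pos_on_stdSimplex_of_coeff_pos` (`f > 0` on `Δ` as soon as all degree-`(N+d)` coefficients of
  `(∑ xᵢ)^N f` are positive) [cite: Scheiderer2008, remark after Thm 2.2.1].
* `handelman_simplex`, `handelman_simplex_degree` — Handelman's theorem (1988) in the case of a
  simplex [cite: Scheiderer2008, Thm 2.2.5]: over `ℝ`, if a polynomial `p` (not necessarily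
  homogeneous) is strictly positive on the simplex `{x | xᵢ ≥ 0, ∑ xᵢ ≤ 1}`, then `p` is a linear
  combination with strictly positive coefficients of products `(1 - ∑ xᵢ)^k · ∏ xᵢ^{γᵢ}` of the
  linear polynomials `x₁, …, xₙ, 1 - ∑ xᵢ` defining the simplex — and (`_degree`) for every
  `D ≥ D₀` one may use exactly the products of total degree `D`, all with strictly positive
  coefficients. As Scheiderer remarks after Thm 2.2.5,
  for a simplex this is immediate from Pólya's theorem: homogenise `p` with the form
  `x₀ + x₁ + ⋯ + xₙ` (so that the homogenisation is `> 0` on the standard simplex in one more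
  variable), apply `polya`, and substitute `x₀ ↦ 1 - ∑ xᵢ`.
* `handelman_of_sum_eq_one` — the same by-degree conclusion for arbitrary real polynomials
  `f₁, …, f_r` with `∑ f_j = 1` that generate `ℝ[x]` (every `xᵢ` a polynomial in the `f_j`) and
  `p > 0` on `K = {f_j ≥ 0 ∀ j}`: `p = ∑_{|β| = D} c_β ∏ f_j^{β_j}` with all `c_β > 0` for every
  large `D`. For linear `f_j` this is Handelman's theorem [cite: Scheiderer2008, Thm 2.2.5] for a
  compact polytope in the presentation `∑ f_j = 1`; in general it is the Representation Theorem
  [cite: Scheiderer2008, Thm 1.5.9] for the preprime `PP(f₁, …, f_r)`, archimedean because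
  `∑ f_j = 1` (Scheiderer 2.2.2, the Berr–Wörmann argument), proved here along 2.2.2 from `polya`
  (pull `p` back along `y ↦ f`, add `c · ∑_j (y_j - f_j(g(y)))²` to make it positive on the whole
  simplex, homogenise, apply Pólya, push forward). The reduction of an arbitrary compact polytope
  with non-empty interior to this presentation (Minkowski) and the Powers–Reznick degree bound for
  polytopes [cite: PowersReznick2001, §1] are not formalised here.
* `handelman_cube_degree` — the unit cube `[0, 1]^n`: `p > 0` on the cube is, for every large `D`,
  a combination with all coefficients `> 0` of the degree-`D` products `∏ xᵢ^{aᵢ} (1 - xᵢ)^{bᵢ}` of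
  the `2n` facet polynomials (generators `xᵢ / n`, `(1 - xᵢ) / n`).

## References

* G. Pólya, *Über positive Darstellung von Polynomen*, Vierteljahrsschrift Naturforsch. Ges.
  Zürich 73 (1928), 141–145 [cite: Polya1928, Satz].
* G. H. Hardy, J. E. Littlewood, G. Pólya, *Inequalities*, 2nd ed., Cambridge Univ. Press (1952),
  §2.24, Theorem 56 and its proof via (2.24.2)–(2.24.10) [cite: HardyLittlewoodPolya1952, Thm 56].
* V. Powers, B. Reznick, *A new bound for Pólya's Theorem with applications to polynomials
  positive on polyhedra*, J. Pure Appl. Algebra 164 (2001), 221–229, Theorem 1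
  [cite: PowersReznick2001, Thm 1].
* C. Scheiderer, *Positivity and sums of squares: a guide to recent results*, in: Emerging
  Applications of Algebraic Geometry, IMA Vol. Math. Appl. 149, Springer (2009), 271–324:
  Theorem 2.2.1 (Pólya), the remark following it (the converse), §2.2.3 (the Powers–Reznick
  bound), Theorem 2.2.5 (Handelman) with the remark following it (the simplex case), §2.2.2
  (Pólya's theorem and archimedean preprimes, after Berr–Wörmann) and Theorem 1.5.9 (the
  Representation Theorem) [cite: Scheiderer2008, Thm 2.2.1].
* D. Handelman, *Representing polynomials by positive linear functions on compact convex
  polyhedra*, Pacific J. Math. 132 (1988), 35–62 [cite: Handelman1988, Thm (Scheiderer 2.2.5)].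
-/

noncomputable section

open MvPolynomial Finset
open scoped BigOperators

namespace Literature.Algebra.Polynomial

section CommSemiring

variable {R : Type*} [CommSemiring R] {ι : Type*} [Fintype ι]

/-- A form `f` of degree `d` is homogeneous under scaling of the argument:
`f(c • x) = c^d · f(x)`. [folklore] -/
private theorem eval_smul_of_isHomogeneous (f : MvPolynomial ι R) {d : ℕ}
    (hf : f.IsHomogeneous d) (c : R) (x : ι → R) : eval (c • x) f = c ^ d * eval x f := by
  rw [eval_eq', eval_eq', Finset.mul_sum]
  refine Finset.sum_congr rfl fun α hα => ?_
  have hdeg : ∑ i, α i = d := by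
    rw [← Finsupp.degree_eq_sum, Finsupp.degree_apply]
    exact (hf.degree_eq_sum_deg_support hα).symm
  simp_rw [Pi.smul_apply, smul_eq_mul, mul_pow, Finset.prod_mul_distrib,
    Finset.prod_pow_eq_pow_sum, hdeg]
  ring

/-- On the standard simplex, multiplying by a power of `x₁ + ⋯ + xₙ` does not change the values:
`((∑ xᵢ)^N · f)(x) = f(x)` whenever `∑ xᵢ = 1`. [folklore] -/
private theorem eval_sum_X_pow_mul_of_sum_eq_one (f : MvPolynomial ι R) (N : ℕ) {x : ι → R}
    (hx : ∑ i, x i = 1) : eval x ((∑ i, X i : MvPolynomial ι R) ^ N * f) = eval x f := by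
  simp [map_sum, hx]

/-- The coefficient formula behind Pólya's theorem [cite: HardyLittlewoodPolya1952, (2.24.10)]:
for a form `f = ∑ a_α x^α` of degree `d` and a multi-index `β` with `|β| = N + d`,
`(∏ᵢ βᵢ!) · [x^β]((x₁ + ⋯ + xₙ)^N · f) = N! · ∑_α a_α · ∏ᵢ βᵢ (βᵢ - 1) ⋯ (βᵢ - αᵢ + 1)`
(a falling factorial with `αᵢ > βᵢ` vanishes, so the sum may run over all `α`). -/
theorem prod_factorial_mul_coeff_sum_X_pow_mul (f : MvPolynomial ι R) {d : ℕ}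
    (hf : f.IsHomogeneous d) (N : ℕ) (β : ι →₀ ℕ) (hβ : β.degree = N + d) :
    (∏ i, ((β i).factorial : R)) * coeff β ((∑ i, X i : MvPolynomial ι R) ^ N * f) =
      (N.factorial : R) *
        ∑ α ∈ f.support, coeff α f * ∏ i, ((β i).descFactorial (α i) : R) := by
  classical
  set S : MvPolynomial ι R := ∑ i, X i with hS
  conv_lhs => rw [f.as_sum, Finset.mul_sum, coeff_sum, Finset.mul_sum]
  rw [Finset.mul_sum]
  refine Finset.sum_congr rfl fun α hα => ?_
  rw [coeff_mul_monomial']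
  split_ifs with hle
  · -- `α ≤ β`: the coefficient of `x^(β - α)` in `S ^ N` is the multinomial coefficient.
    have hdegα : α.degree = d := by
      rw [Finsupp.degree_apply]; exact (hf.degree_eq_sum_deg_support hα).symm
    have hdegN : (β - α).degree = N := by
      have h := congrArg Finsupp.degree (tsub_add_cancel_of_le hle)
      rw [map_add, hdegα, hβ] at h
      omega
    have hcoeff : coeff (β - α) (S ^ N) = ((β - α).multinomial : R) := by
      rw [hS, coeff_sum_X_pow_of_fintype, if_pos]
      rw [Finsupp.degree_apply] at hdegN
      simpa [Finsupp.sum] using hdegN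
    have key : (∏ i, (β i).factorial) * (β - α).multinomial =
        N.factorial * ∏ i, (β i).descFactorial (α i) := by
      have h1 : ∀ i, (β i).factorial = ((β - α) i).factorial * (β i).descFactorial (α i) :=
        fun i => by rw [Finsupp.tsub_apply, Nat.factorial_mul_descFactorial (hle i)]
      have h2 : (∏ i, ((β - α) i).factorial) * (β - α).multinomial = N.factorial := by
        rw [Finsupp.multinomial_eq_of_support_subset (Finset.subset_univ _),
          Nat.multinomial_spec, ← Finsupp.degree_eq_sum, hdegN]
      calc (∏ i, (β i).factorial) * (β - α).multinomial
          = ((∏ i, ((β - α) i).factorial) * (β - α).multinomial) *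
              ∏ i, (β i).descFactorial (α i) := by
            rw [Finset.prod_congr rfl fun i _ => h1 i, Finset.prod_mul_distrib]; ring
        _ = N.factorial * ∏ i, (β i).descFactorial (α i) := by rw [h2]
    have keyR := congrArg (Nat.cast : ℕ → R) key
    push_cast at keyR
    rw [hcoeff, ← mul_assoc, keyR]
    ring
  · -- `¬ α ≤ β`: some falling factorial vanishes.
    obtain ⟨i, hi⟩ : ∃ i, β i < α i := by
      by_contra h
      push Not at h
      exact hle fun i => h i
    rw [mul_zero, Finset.prod_eq_zero (Finset.mem_univ i)
      (by rw [Nat.descFactorial_eq_zero_iff_lt.mpr hi, Nat.cast_zero]), mul_zero, mul_zero]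

/-- The elementary bound `M^(d+1) ≤ M(M-1)⋯(M-d) + d(d+1)/2 · M^d` comparing a power with the
falling factorial of the same length. [folklore] -/
private theorem pow_succ_le_descFactorial_add_choose_mul_pow (M : ℕ) :
    ∀ d : ℕ, M ^ (d + 1) ≤ M.descFactorial (d + 1) + (d + 1).choose 2 * M ^ d
  | 0 => by simp
  | d + 1 => by
    have ih := pow_succ_le_descFactorial_add_choose_mul_pow M d
    rw [Nat.choose_succ_succ (d + 1) 1, Nat.choose_one_right]
    rcases Nat.lt_or_ge M (d + 2) with hM | hM
    · -- `M ≤ d + 1`: the falling factorial vanishes and `M^(d+2) ≤ (d+1) · M^(d+1)`.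
      rw [Nat.descFactorial_eq_zero_iff_lt.mpr hM, zero_add, pow_succ, add_mul]
      calc M ^ (d + 1) * M ≤ M ^ (d + 1) * (d + 1) := Nat.mul_le_mul_left _ (by omega)
        _ = (d + 1) * M ^ (d + 1) := by ring
        _ ≤ (d + 1) * M ^ (d + 1) + (d + 1).choose 2 * M ^ (d + 1) := Nat.le_add_right _ _
    · -- `M ≥ d + 2`: `M · desc M (d+1) = desc M (d+2) + (d+1) · desc M (d+1)`.
      set D := M.descFactorial (d + 1) with hD
      have hdesc : D ≤ M ^ (d + 1) := Nat.descFactorial_le_pow _ _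
      have hMD : M * D = (M - (d + 1)) * D + (d + 1) * D := by
        rw [← add_mul, Nat.sub_add_cancel (by omega)]
      rw [Nat.descFactorial_succ, ← hD]
      calc M ^ (d + 1 + 1) = M * M ^ (d + 1) := by ring
        _ ≤ M * (D + (d + 1).choose 2 * M ^ d) := Nat.mul_le_mul_left M ih
        _ = (M - (d + 1)) * D + (d + 1) * D + (d + 1).choose 2 * M ^ (d + 1) := by
            rw [mul_add, hMD]; ring
        _ ≤ (M - (d + 1)) * D + (d + 1) * M ^ (d + 1) + (d + 1).choose 2 * M ^ (d + 1) := by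
            gcongr
        _ = (M - (d + 1)) * D + ((d + 1) + (d + 1).choose 2) * M ^ (d + 1) := by ring

/-- With nonnegative coefficients, a polynomial is nonnegative on the nonnegative orthant — the
sense in which a Pólya representation "renders its positive character intuitive"
[cite: HardyLittlewoodPolya1952, §2.24 (p. 57)] [cite: Scheiderer2008, remark after Thm 2.2.1]. -/
theorem eval_nonneg_of_coeff_nonneg {𝕜 : Type*} [CommSemiring 𝕜] [PartialOrder 𝕜]
    [IsOrderedRing 𝕜] (g : MvPolynomial ι 𝕜) (hg : ∀ β, 0 ≤ coeff β g) {x : ι → 𝕜}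
    (hx : ∀ i, 0 ≤ x i) : 0 ≤ eval x g := by
  rw [eval_eq']
  exact Finset.sum_nonneg fun β _ =>
    mul_nonneg (hg β) (Finset.prod_nonneg fun i _ => pow_nonneg (hx i) _)

end CommSemiring

section OrderedField

variable {𝕜 : Type*} [Field 𝕜] [LinearOrder 𝕜] [IsStrictOrderedRing 𝕜]
variable {ι : Type*} [Fintype ι]

/-- The falling-factorial companion of the multinomial theorem: for `|β| = N + d`,
`∑_{|α| = d} c(α) · ∏ᵢ βᵢ(βᵢ-1)⋯(βᵢ-αᵢ+1) = (N+d)(N+d-1)⋯(N+1)`, where `c(α) = d!/(α₁!⋯αₙ!)`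
is the coefficient of `x^α` in `(x₁ + ⋯ + xₙ)^d` (the coefficient formula
`prod_factorial_mul_coeff_sum_X_pow_mul` applied to `f = (∑ xᵢ)^d`). [folklore] -/
private theorem sum_coeff_sum_X_pow_mul_descFactorial_prod (d N : ℕ) (β : ι →₀ ℕ)
    (hβ : β.degree = N + d) :
    ∑ α ∈ ((∑ i, X i : MvPolynomial ι 𝕜) ^ d).support,
        coeff α ((∑ i, X i : MvPolynomial ι 𝕜) ^ d) * ∏ i, ((β i).descFactorial (α i) : 𝕜) =
      ((N + d).descFactorial d : 𝕜) := by
  classical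
  set S : MvPolynomial ι 𝕜 := ∑ i, X i with hS
  have hShom : S.IsHomogeneous 1 := by
    rw [hS]; exact IsHomogeneous.sum _ _ _ fun i _ => isHomogeneous_X 𝕜 i
  have hSd : (S ^ d).IsHomogeneous d := by simpa using hShom.pow d
  have h1 := prod_factorial_mul_coeff_sum_X_pow_mul (S ^ d) hSd N β hβ
  rw [← hS] at h1
  have hcoeffβ : coeff β (S ^ N * S ^ d) = (β.multinomial : 𝕜) := by
    rw [← pow_add, hS, coeff_sum_X_pow_of_fintype, if_pos]
    have h := hβ
    rw [Finsupp.degree_apply] at h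
    simpa [Finsupp.sum] using h
  have key : (∏ i, (β i).factorial) * β.multinomial = N.factorial * (N + d).descFactorial d := by
    rw [Finsupp.multinomial_eq_of_support_subset (Finset.subset_univ _), Nat.multinomial_spec,
      ← Finsupp.degree_eq_sum, hβ]
    have h := Nat.factorial_mul_descFactorial (Nat.le_add_left d N)
    rw [Nat.add_sub_cancel] at h
    exact h.symm
  have keyR := congrArg (Nat.cast : ℕ → 𝕜) key
  push_cast at keyR
  rw [hcoeffβ, keyR] at h1
  exact (mul_left_cancel₀ (Nat.cast_ne_zero.mpr (Nat.factorial_ne_zero N)) h1).symm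

/-- **Pólya's theorem with the Powers–Reznick bound** [cite: PowersReznick2001, Thm 1]
[cite: Scheiderer2008, 2.2.3].
Let `f = ∑_{|α|=d} a_α x^α` be a form of degree `d` over a linearly ordered field with
`|a_α| ≤ L · d!/(α₁!⋯αₙ!)` for all `α` and `f ≥ λ` on the standard simplex `Δ`. If
`λ · (N + d) > L · d(d-1)/2`, i.e. `N > d(d-1)/2 · L/λ - d`, then every monomial of degree `N + d`
has a strictly positive coefficient in `(x₁ + ⋯ + xₙ)^N · f`. (Powers–Reznick state it over `ℝ`
with `L = max |a_α| α!/d!` and `λ = min_Δ f > 0`; the grid-point proof is purely algebraic.) -/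
theorem polya_powersReznick (f : MvPolynomial ι 𝕜) {d : ℕ} (hf : f.IsHomogeneous d)
    {L lam : 𝕜} (hL : ∀ α : ι →₀ ℕ, |coeff α f| ≤ L * (α.multinomial : 𝕜))
    (hpos : ∀ x ∈ stdSimplex 𝕜 ι, lam ≤ eval x f) {N : ℕ}
    (hN : L * (d.choose 2 : 𝕜) < lam * (N + d : 𝕜)) (β : ι →₀ ℕ) (hβ : β.degree = N + d) :
    0 < coeff β ((∑ i, X i : MvPolynomial ι 𝕜) ^ N * f) := by
  classical
  set S : MvPolynomial ι 𝕜 := ∑ i, X i with hS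
  set M : ℕ := N + d with hM_def
  have hNM : L * (d.choose 2 : 𝕜) < lam * (M : 𝕜) := by rw [hM_def]; push_cast; exact hN
  -- positivity of multinomial coefficients, `L ≥ 0`, `M > 0`
  have hcpos : ∀ α : ι →₀ ℕ, (0 : 𝕜) < (α.multinomial : 𝕜) := fun α => by
    rw [Finsupp.multinomial_eq]; exact_mod_cast Nat.multinomial_pos _ _
  have hL0 : 0 ≤ L := by
    by_contra h
    push Not at h
    have h1 := hL 0
    have h2 : L * ((0 : ι →₀ ℕ).multinomial : 𝕜) < 0 := mul_neg_of_neg_of_pos h (hcpos 0)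
    linarith [abs_nonneg (coeff 0 f)]
  have hM : 0 < M := by
    by_contra h
    have hM0 : M = 0 := by omega
    have hd0 : d = 0 := by omega
    rw [hM0, hd0] at hNM
    simp at hNM
  have hMpos : (0 : 𝕜) < (M : 𝕜) := Nat.cast_pos.mpr hM
  have hMne : (M : 𝕜) ≠ 0 := hMpos.ne'
  -- the grid point `β / M` of the simplex
  have hsumβ : ∑ i, ((β i : ℕ) : 𝕜) = (M : 𝕜) := by
    rw [← Nat.cast_sum, ← Finsupp.degree_eq_sum, hβ]
  set y : ι → 𝕜 := fun i => ((β i : ℕ) : 𝕜) with hy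
  set x₀ : ι → 𝕜 := fun i => ((β i : ℕ) : 𝕜) / (M : 𝕜) with hx₀
  have hx₀mem : x₀ ∈ stdSimplex 𝕜 ι := by
    refine ⟨fun i => div_nonneg (Nat.cast_nonneg _) hMpos.le, ?_⟩
    simp only [hx₀]
    rw [← Finset.sum_div, hsumβ, div_self hMne]
  have hyx : y = (M : 𝕜) • x₀ := by
    funext i; simp only [hy, hx₀, Pi.smul_apply, smul_eq_mul]; field_simp
  have hevaly : eval y f = (M : 𝕜) ^ d * eval x₀ f := by
    rw [hyx]; exact eval_smul_of_isHomogeneous f hf _ _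
  have hevaly_ge : (M : 𝕜) ^ d * lam ≤ eval y f := by
    rw [hevaly]; exact mul_le_mul_of_nonneg_left (hpos x₀ hx₀mem) (pow_nonneg hMpos.le _)
  -- the index set `T` of all multi-indices of degree `d` (= support of `S ^ d`) and `c(α)`
  set T := (S ^ d).support with hT
  have hcT : ∀ α ∈ T, coeff α (S ^ d) = (α.multinomial : 𝕜) := by
    intro α hα
    have h := mem_support_iff.mp hα
    rw [hS, coeff_sum_X_pow_of_fintype] at h ⊢
    split_ifs at h ⊢ with hd
    · rfl
    · exact (h (by simp)).elim
  have hsub : f.support ⊆ T := by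
    intro α hα
    have hdegα : α.degree = d := by
      rw [Finsupp.degree_apply]; exact (hf.degree_eq_sum_deg_support hα).symm
    rw [hT, mem_support_iff, hS, coeff_sum_X_pow_of_fintype, if_pos]
    · exact (hcpos α).ne'
    · rw [Finsupp.degree_apply] at hdegα
      simpa [Finsupp.sum] using hdegα
  -- abbreviations: falling factorials `D α` and powers `P α` at the grid point
  set D : (ι →₀ ℕ) → 𝕜 := fun α => ∏ i, ((β i).descFactorial (α i) : 𝕜) with hD
  set P : (ι →₀ ℕ) → 𝕜 := fun α => ∏ i, ((β i : ℕ) : 𝕜) ^ (α i) with hP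
  have hDP : ∀ α, 0 ≤ D α ∧ D α ≤ P α := fun α => by
    refine ⟨Finset.prod_nonneg fun i _ => Nat.cast_nonneg _, ?_⟩
    simp only [hD, hP]
    have h : (∏ i, (β i).descFactorial (α i)) ≤ ∏ i, (β i) ^ (α i) :=
      Finset.prod_le_prod (fun i _ => Nat.zero_le _) fun i _ => Nat.descFactorial_le_pow _ _
    exact_mod_cast h
  -- (1) the coefficient formula, summed over `T`
  have h1 : (∏ i, ((β i).factorial : 𝕜)) * coeff β (S ^ N * f) =
      (N.factorial : 𝕜) * ∑ α ∈ T, coeff α f * D α := by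
    rw [hS, prod_factorial_mul_coeff_sum_X_pow_mul f hf N β hβ]
    congr 1
    exact Finset.sum_subset hsub fun α _ hα => by rw [notMem_support_iff.mp hα, zero_mul]
  -- (2) the power sums: `∑_T a_α P α = f(β) = M^d f(x₀)` and `∑_T c(α) P α = M ^ d`
  have h2f : ∑ α ∈ T, coeff α f * P α = eval y f := by
    rw [eval_eq']
    exact (Finset.sum_subset hsub fun α _ hα => by rw [notMem_support_iff.mp hα, zero_mul]).symm
  have h2S : ∑ α ∈ T, coeff α (S ^ d) * P α = (M : 𝕜) ^ d := by
    rw [hT, ← eval_eq', map_pow, hS, map_sum]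
    simp only [eval_X]
    rw [hsumβ]
  -- (3) the falling-factorial sums: `∑_T c(α) D α = M (M-1) ⋯ (M-d+1)`
  have h3S : ∑ α ∈ T, coeff α (S ^ d) * D α = (M.descFactorial d : 𝕜) := by
    rw [hT, hS, hM_def]
    exact sum_coeff_sum_X_pow_mul_descFactorial_prod d N β hβ
  -- (4) the defect `∑_T a_α (P α - D α)` is at most `L · (M^d - M(M-1)⋯(M-d+1))`
  have h4 : ∑ α ∈ T, coeff α f * (P α - D α) ≤
      L * ((M : 𝕜) ^ d - (M.descFactorial d : 𝕜)) := by
    have hrhs : L * ((M : 𝕜) ^ d - (M.descFactorial d : 𝕜)) =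
        ∑ α ∈ T, L * (α.multinomial : 𝕜) * (P α - D α) := by
      rw [← h2S, ← h3S, ← Finset.sum_sub_distrib, Finset.mul_sum]
      refine Finset.sum_congr rfl fun α hα => ?_
      rw [hcT α hα]; ring
    rw [hrhs]
    refine Finset.sum_le_sum fun α _ => ?_
    have hPD : 0 ≤ P α - D α := sub_nonneg.mpr (hDP α).2
    exact (mul_le_mul_of_nonneg_right (le_abs_self _) hPD).trans
      (mul_le_mul_of_nonneg_right (hL α) hPD)
  -- (5) the elementary bound makes the defect strictly smaller than the main term
  have h5 : L * ((M : 𝕜) ^ d - (M.descFactorial d : 𝕜)) < lam * (M : 𝕜) ^ d := by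
    rcases Nat.eq_zero_or_pos d with hd | hd
    · rw [hd] at hNM ⊢
      simp only [Nat.choose_zero_succ, Nat.cast_zero, mul_zero] at hNM
      simp only [pow_zero, Nat.descFactorial_zero, Nat.cast_one, sub_self, mul_zero, mul_one]
      exact lt_of_mul_lt_mul_right (by rwa [zero_mul]) hMpos.le
    · have hd1 : d - 1 + 1 = d := Nat.sub_add_cancel hd
      have h := pow_succ_le_descFactorial_add_choose_mul_pow M (d - 1)
      rw [hd1] at h
      have h' : (M : 𝕜) ^ d ≤ (M.descFactorial d : 𝕜) + (d.choose 2 : 𝕜) * (M : 𝕜) ^ (d - 1) := by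
        exact_mod_cast h
      have hpowpos : (0 : 𝕜) < (M : 𝕜) ^ (d - 1) := pow_pos hMpos _
      have hMpow : (M : 𝕜) * (M : 𝕜) ^ (d - 1) = (M : 𝕜) ^ d := by rw [← pow_succ', hd1]
      calc L * ((M : 𝕜) ^ d - (M.descFactorial d : 𝕜))
          ≤ L * ((d.choose 2 : 𝕜) * (M : 𝕜) ^ (d - 1)) :=
            mul_le_mul_of_nonneg_left (by linarith) hL0
        _ = L * (d.choose 2 : 𝕜) * (M : 𝕜) ^ (d - 1) := by ring
        _ < lam * (M : 𝕜) * (M : 𝕜) ^ (d - 1) := mul_lt_mul_of_pos_right hNM hpowpos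
        _ = lam * (M : 𝕜) ^ d := by rw [mul_assoc, hMpow]
  -- conclusion: `∑_T a_α D α = ∑_T a_α P α - ∑_T a_α (P α - D α) ≥ M^d λ - L (M^d - M(M-1)⋯) > 0`
  have hmain : 0 < ∑ α ∈ T, coeff α f * D α := by
    have hsplit : ∑ α ∈ T, coeff α f * D α =
        ∑ α ∈ T, coeff α f * P α - ∑ α ∈ T, coeff α f * (P α - D α) := by
      rw [← Finset.sum_sub_distrib]; exact Finset.sum_congr rfl fun α _ => by ring
    rw [hsplit, h2f]
    linarith [hevaly_ge, h4, h5]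
  have hprod : (0 : 𝕜) < ∏ i, ((β i).factorial : 𝕜) :=
    Finset.prod_pos fun i _ => Nat.cast_pos.mpr (Nat.factorial_pos _)
  have hNfac : (0 : 𝕜) < (N.factorial : 𝕜) := Nat.cast_pos.mpr (Nat.factorial_pos _)
  have h6 : 0 < (∏ i, ((β i).factorial : 𝕜)) * coeff β (S ^ N * f) := by
    rw [h1]; exact mul_pos hNfac hmain
  exact (mul_pos_iff_of_pos_left hprod).mp h6

/-- **Pólya's theorem** (1928) [cite: Polya1928, Satz] [cite: HardyLittlewoodPolya1952, Thm 56]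
[cite: Scheiderer2008, Thm 2.2.1]:
if a real form `f` of degree `d` is strictly positive on the standard simplex
`Δ = {x | xᵢ ≥ 0, ∑ xᵢ = 1}`, then for all sufficiently large `N` every monomial of degree `N + d`
has a strictly positive coefficient in `(x₁ + ⋯ + xₙ)^N · f` — so that
`f = G / (x₁ + ⋯ + xₙ)^N` with `G` a form all of whose coefficients are positive. -/
theorem polya {ι : Type*} [Fintype ι] (f : MvPolynomial ι ℝ) {d : ℕ} (hf : f.IsHomogeneous d)
    (hpos : ∀ x ∈ stdSimplex ℝ ι, 0 < eval x f) :
    ∃ N₀ : ℕ, ∀ N : ℕ, N₀ ≤ N → ∀ β : ι →₀ ℕ, β.degree = N + d →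
      0 < coeff β ((∑ i, X i : MvPolynomial ι ℝ) ^ N * f) := by
  classical
  cases isEmpty_or_nonempty ι with
  | inl hι =>
    -- no variables: only `β = 0`, and `0 = N + d` is impossible for `N ≥ 1`
    refine ⟨1, fun N hN β hβ => ?_⟩
    have hβ0 : β = 0 := Finsupp.ext fun i => isEmptyElim i
    rw [hβ0, map_zero] at hβ
    omega
  | inr hι =>
    -- the minimum `λ > 0` of `f` on the compact simplex and the coefficient bound `L`
    obtain ⟨x₀, hx₀, hmin⟩ := (isCompact_stdSimplex ℝ ι).exists_isMinOn
      ⟨_, single_mem_stdSimplex ℝ (Classical.arbitrary ι)⟩ (continuous_eval f).continuousOn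
    set lam := eval x₀ f with hlam
    have hlam_pos : 0 < lam := hpos x₀ hx₀
    have hlam_le : ∀ x ∈ stdSimplex ℝ ι, lam ≤ eval x f := fun x hx => hmin hx
    set L := ∑ α ∈ f.support, |coeff α f| with hL_def
    have hL0 : 0 ≤ L := Finset.sum_nonneg fun α _ => abs_nonneg _
    have hL : ∀ α : ι →₀ ℕ, |coeff α f| ≤ L * (α.multinomial : ℝ) := by
      intro α
      have hc : (1 : ℝ) ≤ (α.multinomial : ℝ) := by
        rw [Finsupp.multinomial_eq]; exact_mod_cast Nat.multinomial_pos _ _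
      by_cases hα : α ∈ f.support
      · exact (Finset.single_le_sum (fun α _ => abs_nonneg (coeff α f)) hα).trans
          (le_mul_of_one_le_right hL0 hc)
      · rw [notMem_support_iff.mp hα, abs_zero]
        exact mul_nonneg hL0 (zero_le_one.trans hc)
    -- choose `N₀ > d(d-1)/2 · L/λ`
    obtain ⟨N₀, hN₀⟩ := exists_nat_gt (L * (d.choose 2 : ℝ) / lam)
    refine ⟨N₀, fun N hN β hβ => polya_powersReznick f hf hL hlam_le ?_ β hβ⟩
    have h1 : L * (d.choose 2 : ℝ) < lam * (N₀ : ℝ) := by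
      rw [div_lt_iff₀ hlam_pos] at hN₀; linarith
    have h2 : (N₀ : ℝ) ≤ (N : ℝ) := Nat.cast_le.mpr hN
    have h3 : (0 : ℝ) ≤ (d : ℝ) := Nat.cast_nonneg d
    nlinarith

/-- Soundness of Pólya certificates, pointwise: if `g` is a form of degree `n` all of whose
degree-`n` coefficients are strictly positive, then `g > 0` on the standard simplex (some
coordinate `xᵢ` is positive, and the monomial `xᵢ^n` alone contributes `> 0`). [folklore] -/
private theorem eval_pos_of_coeff_pos_of_mem_stdSimplex (g : MvPolynomial ι 𝕜) {n : ℕ}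
    (hg : g.IsHomogeneous n) (hcoeff : ∀ β : ι →₀ ℕ, β.degree = n → 0 < coeff β g)
    {x : ι → 𝕜} (hx : x ∈ stdSimplex 𝕜 ι) : 0 < eval x g := by
  classical
  obtain ⟨hx0, hx1⟩ := hx
  -- some coordinate is positive
  obtain ⟨i, hi⟩ : ∃ i, 0 < x i := by
    by_contra h
    push Not at h
    have : ∑ i, x i = 0 := Finset.sum_eq_zero fun i _ => le_antisymm (h i) (hx0 i)
    rw [this] at hx1
    exact zero_ne_one hx1
  set β₀ : ι →₀ ℕ := Finsupp.single i n with hβ₀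
  have hβ₀deg : β₀.degree = n := by rw [hβ₀, Finsupp.degree_single]
  have hβ₀mem : β₀ ∈ g.support := mem_support_iff.mpr (hcoeff β₀ hβ₀deg).ne'
  have hterm : ∀ β ∈ g.support, 0 ≤ coeff β g * ∏ j, x j ^ β j := fun β hβ => by
    have hdeg : β.degree = n := by
      rw [Finsupp.degree_apply]; exact (hg.degree_eq_sum_deg_support hβ).symm
    exact mul_nonneg (hcoeff β hdeg).le (Finset.prod_nonneg fun j _ => pow_nonneg (hx0 j) _)
  rw [eval_eq']
  refine lt_of_lt_of_le ?_ (Finset.single_le_sum hterm hβ₀mem)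
  refine mul_pos (hcoeff β₀ hβ₀deg) (Finset.prod_pos fun j _ => ?_)
  by_cases hj : j = i
  · subst hj; exact pow_pos hi _
  · rw [hβ₀, Finsupp.single_eq_of_ne hj, pow_zero]; exact one_pos

/-- Soundness of Pólya certificates, the easy converse of Pólya's theorem
[cite: Scheiderer2008, remark after Thm 2.2.1] ("conversely, the conclusion of Theorem 2.2.1
implies the strict positivity condition for `f`"): if for some `N` every monomial of degree `N + d`
has a strictly positive coefficient in `(x₁ + ⋯ + xₙ)^N · f`, where `f` is a form of degree `d`,
then `f > 0` on the standard simplex. -/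
theorem pos_on_stdSimplex_of_coeff_pos (f : MvPolynomial ι 𝕜) {d N : ℕ}
    (hf : f.IsHomogeneous d)
    (hcoeff : ∀ β : ι →₀ ℕ, β.degree = N + d →
      0 < coeff β ((∑ i, X i : MvPolynomial ι 𝕜) ^ N * f))
    {x : ι → 𝕜} (hx : x ∈ stdSimplex 𝕜 ι) : 0 < eval x f := by
  classical
  have hShom : (∑ i, X i : MvPolynomial ι 𝕜).IsHomogeneous 1 :=
    IsHomogeneous.sum _ _ _ fun i _ => isHomogeneous_X 𝕜 i
  have hg : ((∑ i, X i : MvPolynomial ι 𝕜) ^ N * f).IsHomogeneous (N + d) := by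
    simpa using (hShom.pow N).mul hf
  rw [← eval_sum_X_pow_mul_of_sum_eq_one f N hx.2]
  exact eval_pos_of_coeff_pos_of_mem_stdSimplex _ hg hcoeff hx

end OrderedField

section Handelman

/-! ### Handelman's theorem on a simplex -/

/-- **Handelman's theorem, simplex case, by degree** [cite: Scheiderer2008, Thm 2.2.5]
[cite: Handelman1988, Thm (Scheiderer 2.2.5)]: if a real polynomial `p` is strictly positive on
the simplex `K = {x | xᵢ ≥ 0 (all i), ∑ xᵢ ≤ 1}`, then for every sufficiently large `D` it is a
linear combination, with *all* coefficients strictly positive, of the products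
`(1 - ∑ xᵢ)^{γ₀} · ∏ xᵢ^{γᵢ}` of total degree `|γ| = D` of the linear polynomials
`x₁, …, xₙ, 1 - ∑ xᵢ` defining `K` (so the degree-`D` "Handelman linear programme" for `p` is
strictly feasible for all `D ≥ D₀`). Proof ("in the particular case where `K` is a simplex,
this is immediate" from Pólya's theorem — Scheiderer, after Thm 2.2.5): with `d = deg p` and
`p = p₀ + ⋯ + p_d` its homogeneous components, the form
`F(x₀, x) = ∑_k p_k(x) · (x₀ + ∑ xᵢ)^{d-k}` in one more variable is strictly positive on the
standard simplex (where it agrees with `p(x)`), so by `polya` every `(x₀ + ∑ xᵢ)^N · F` with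
`N ≥ N₀` has all its degree-`(N + d)` coefficients strictly positive; substituting
`x₀ ↦ 1 - ∑ xᵢ` turns `x₀ + ∑ xᵢ` into `1` and `F` into `p`. -/
theorem handelman_simplex_degree {ι : Type*} [Fintype ι] [DecidableEq ι] (p : MvPolynomial ι ℝ)
    (hpos : ∀ x : ι → ℝ, (∀ i, 0 ≤ x i) → ∑ i, x i ≤ 1 → 0 < eval x p) :
    ∃ D₀ : ℕ, ∀ D : ℕ, D₀ ≤ D → ∃ c : (Option ι →₀ ℕ) → ℝ,
      (∀ γ : Option ι →₀ ℕ, γ.degree = D → 0 < c γ) ∧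
      p = ∑ γ ∈ (univ : Finset (Option ι)).finsuppAntidiag D,
        C (c γ) * ((1 - ∑ i, X i) ^ γ none * ∏ i, X i ^ γ (some i)) := by
  classical
  -- Step 1: homogenise `p` with the form `S = x₀ + ∑ xᵢ` (the new variable is `none`).
  set S : MvPolynomial (Option ι) ℝ := ∑ j, X j with hS
  set F : MvPolynomial (Option ι) ℝ := ∑ k ∈ range (p.totalDegree + 1),
    rename some (homogeneousComponent k p) * S ^ (p.totalDegree - k) with hF
  have hShom : S.IsHomogeneous 1 := by
    rw [hS]; exact IsHomogeneous.sum _ _ _ fun j _ => isHomogeneous_X ℝ j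
  have hFhom : F.IsHomogeneous p.totalDegree := by
    rw [hF]
    refine IsHomogeneous.sum _ _ _ fun k hk => ?_
    have hk' : k ≤ p.totalDegree := Nat.lt_succ_iff.mp (mem_range.mp hk)
    have h := ((homogeneousComponent_isHomogeneous k p).rename_isHomogeneous (f := some)).mul
      (hShom.pow (p.totalDegree - k))
    rwa [one_mul, Nat.add_sub_cancel' hk'] at h
  -- Step 2: the substitution `x₀ ↦ 1 - ∑ xᵢ`, `xᵢ ↦ xᵢ` maps `S ↦ 1` and `F ↦ p`.
  set φ : MvPolynomial (Option ι) ℝ →ₐ[ℝ] MvPolynomial ι ℝ :=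
    aeval fun o : Option ι => (o.elim (1 - ∑ i, X i) X : MvPolynomial ι ℝ) with hφ
  have hφS : φ S = 1 := by
    rw [hS, map_sum, Fintype.sum_option]
    simp [hφ]
  have hφre : ∀ q : MvPolynomial ι ℝ, φ (rename some q) = q := fun q => by
    rw [hφ, aeval_rename]
    have hcomp : ((fun o : Option ι => (o.elim (1 - ∑ i, X i) X : MvPolynomial ι ℝ)) ∘ some)
        = X := funext fun _ => rfl
    rw [hcomp, aeval_X_left_apply]
  have hφF : φ F = p := by
    rw [hF, map_sum]
    simp_rw [map_mul, map_pow, hφS, one_pow, mul_one, hφre]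
    exact sum_homogeneousComponent p
  have hφmon : ∀ (β : Option ι →₀ ℕ) (a : ℝ),
      φ (monomial β a) = C a * ((1 - ∑ i, X i) ^ β none * ∏ i, X i ^ β (some i)) := by
    intro β a
    rw [hφ, aeval_monomial, algebraMap_eq, Finsupp.prod_fintype _ _ fun _ => pow_zero _,
      Fintype.prod_option]
    simp only [Option.elim_none, Option.elim_some]
  -- Step 3: `F > 0` on the standard simplex in the variables `Option ι`, where `F = p`.
  have hFpos : ∀ y ∈ stdSimplex ℝ (Option ι), 0 < eval y F := by
    rintro y ⟨hy0, hy1⟩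
    have hyS : eval y S = 1 := by rw [hS, map_sum]; simpa using hy1
    have hyF : eval y F = eval (y ∘ some) p := by
      rw [hF, map_sum]
      simp_rw [map_mul, map_pow, hyS, one_pow, mul_one, eval_rename]
      rw [← map_sum, sum_homogeneousComponent]
    rw [hyF]
    refine hpos _ (fun i => hy0 (some i)) ?_
    rw [Fintype.sum_option] at hy1
    have hn := hy0 none
    simp only [Function.comp_apply]
    linarith
  -- Step 4: Pólya's theorem for `F`, and the substitution.
  obtain ⟨N₀, hN₀⟩ := polya F hFhom hFpos
  refine ⟨N₀ + p.totalDegree, fun D hD => ?_⟩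
  obtain ⟨N, rfl⟩ : ∃ N, D = N + p.totalDegree := ⟨D - p.totalDegree, by omega⟩
  have hN : N₀ ≤ N := by omega
  set G : MvPolynomial (Option ι) ℝ := S ^ N * F with hG
  have hGhom : G.IsHomogeneous (N + p.totalDegree) := by
    simpa using (hShom.pow N).mul hFhom
  have hφG : φ G = p := by rw [hG, map_mul, map_pow, hφS, one_pow, one_mul, hφF]
  have hsupp : G.support ⊆ (univ : Finset (Option ι)).finsuppAntidiag (N + p.totalDegree) :=
    fun β hβ => by
      rw [mem_finsuppAntidiag]
      refine ⟨?_, subset_univ _⟩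
      rw [← Finsupp.degree_eq_sum, Finsupp.degree_apply]
      exact (hGhom.degree_eq_sum_deg_support hβ).symm
  refine ⟨fun β => coeff β G, fun β hβ => hN₀ N hN β hβ, ?_⟩
  conv_lhs => rw [← hφG, G.as_sum, map_sum]
  rw [sum_subset hsupp fun β _ hβ => by rw [notMem_support_iff.mp hβ, monomial_zero, map_zero]]
  exact sum_congr rfl fun β _ => hφmon β _

/-- **Handelman's theorem, simplex case** [cite: Scheiderer2008, Thm 2.2.5]
[cite: Handelman1988, Thm (Scheiderer 2.2.5)]: if a real polynomial `p` is strictly positive on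
the simplex `K = {x | xᵢ ≥ 0 (all i), ∑ xᵢ ≤ 1}`, then `p` lies in the preprime generated by the
linear polynomials `x₁, …, xₙ, 1 - ∑ xᵢ` defining `K`: explicitly,
`p = ∑_γ c_γ · (1 - ∑ xᵢ)^{γ₀} · ∏ xᵢ^{γᵢ}` (finite sum) with real numbers `c_γ > 0`
(from `handelman_simplex_degree`). -/
theorem handelman_simplex {ι : Type*} [Fintype ι] (p : MvPolynomial ι ℝ)
    (hpos : ∀ x : ι → ℝ, (∀ i, 0 ≤ x i) → ∑ i, x i ≤ 1 → 0 < eval x p) :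
    ∃ (s : Finset (Option ι →₀ ℕ)) (c : (Option ι →₀ ℕ) → ℝ), (∀ γ ∈ s, 0 < c γ) ∧
      p = ∑ γ ∈ s, C (c γ) * ((1 - ∑ i, X i) ^ γ none * ∏ i, X i ^ γ (some i)) := by
  classical
  obtain ⟨D₀, hD₀⟩ := handelman_simplex_degree p hpos
  obtain ⟨c, hc, hp⟩ := hD₀ D₀ le_rfl
  refine ⟨_, c, fun γ hγ => hc γ ?_, hp⟩
  rw [mem_finsuppAntidiag] at hγ
  rw [Finsupp.degree_eq_sum]; exact hγ.1

end Handelman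

section HandelmanGeneral

/-! ### Handelman's theorem for generators summing to one, and for the unit cube -/

/-- **Handelman's theorem in Pólya-normalised presentation, by degree**
[cite: Scheiderer2008, Thm 2.2.5] [cite: Scheiderer2008, Thm 1.5.9 (with 2.2.2)]
[cite: Handelman1988, Thm (Scheiderer 2.2.5)] [cite: PowersReznick2001, §1].
Let `f_j` (`j ∈ J`) be real polynomials in the variables `x_i` (`i ∈ ι`) with `∑_j f_j = 1` such
that every `x_i` is a polynomial `g_i(f_1, …, f_r)` in the `f_j` (i.e. `y_j ↦ f_j` maps `ℝ[y]`
onto `ℝ[x]`), and let `K = {x | f_j(x) ≥ 0 for all j}`. If `p > 0` on `K`, then for every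
sufficiently large `D` one has `p = ∑_{|β| = D} c_β ∏_j f_j^{β_j}` with *all* `c_β > 0`.
For `f_j` of degree one this is Handelman's theorem (Scheiderer Thm 2.2.5) for the compact
polytope `K` presented with `∑ f_j = 1` — a presentation every compact polytope with non-empty
interior admits after rescaling the `f_j` and adding one redundant linear constraint (the
classical Minkowski argument mentioned by Scheiderer after 2.2.5, not formalised here) — in the
sharp "all products of one large degree" form that Pólya's theorem yields (Powers–Reznick); in
general it is the Representation Theorem 1.5.9 for the preprime generated by the `f_j`, which is
archimedean because `∑ f_j = 1` (Scheiderer 2.2.2, after Berr–Wörmann). Proof, following 2.2.2: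
with `ψ : y_j ↦ f_j`, `Q = p(g(y))` and `R = ∑_j (y_j - f_j(g(y)))²` one has `ψ(Q) = p` and
`ψ(R) = 0`; on the standard simplex `Δ_J` the zero set of `R` consists of the points with
`y = f(g(y))`, where `Q(y) = p(g(y)) > 0` since `g(y) ∈ K`; by compactness `Q + c·R > 0` on
`Δ_J` for some real `c ≥ 0`; homogenise `Q + c·R` with `∑ y_j`, apply `polya`, substitute
`y_j ↦ f_j`. -/
theorem handelman_of_sum_eq_one {ι J : Type*} [Fintype ι] [Fintype J] [DecidableEq J]
    (f : J → MvPolynomial ι ℝ) (hsum : ∑ j, f j = 1)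
    (g : ι → MvPolynomial J ℝ) (hg : ∀ i, aeval f (g i) = X i)
    (p : MvPolynomial ι ℝ) (hpos : ∀ x : ι → ℝ, (∀ j, 0 ≤ eval x (f j)) → 0 < eval x p) :
    ∃ D₀ : ℕ, ∀ D : ℕ, D₀ ≤ D → ∃ c : (J →₀ ℕ) → ℝ, (∀ β : J →₀ ℕ, β.degree = D → 0 < c β) ∧
      p = ∑ β ∈ (univ : Finset J).finsuppAntidiag D, C (c β) * ∏ j, f j ^ β j := by
  classical
  -- the substitution `aeval f : y_j ↦ f_j(x)` maps `S = ∑ y_j ↦ 1` and `q(g(y)) ↦ q(x)`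
  set S : MvPolynomial J ℝ := ∑ j, X j with hS
  have hShom : S.IsHomogeneous 1 := by
    rw [hS]; exact IsHomogeneous.sum _ _ _ fun j _ => isHomogeneous_X ℝ j
  have hψS : aeval f S = 1 := by
    rw [hS, map_sum, ← hsum]; exact sum_congr rfl fun j _ => aeval_X f j
  have hψg : ∀ q : MvPolynomial ι ℝ, aeval f (aeval g q) = q := fun q => by
    rw [comp_aeval_apply]
    simp_rw [hg]
    exact aeval_X_left_apply q
  have heval : ∀ (y : J → ℝ) (q : MvPolynomial ι ℝ),
      eval y (aeval g q) = eval (fun i => eval y (g i)) q := fun y q => by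
    have h := comp_aeval_apply g (aeval y : MvPolynomial J ℝ →ₐ[ℝ] ℝ) q
    simpa only [aeval_eq_eval] using h
  -- `Q = p(g(y))` and `R = ∑_j (y_j - f_j(g(y)))²`
  set Q : MvPolynomial J ℝ := aeval g p with hQ
  set R : MvPolynomial J ℝ := ∑ j, (X j - aeval g (f j)) ^ 2 with hR
  have hψR : aeval f R = 0 := by
    rw [hR, map_sum]
    refine sum_eq_zero fun j _ => ?_
    rw [map_pow, map_sub, hψg, aeval_X, sub_self, zero_pow two_ne_zero]
  have hR0 : ∀ y : J → ℝ, 0 ≤ eval y R := fun y => by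
    rw [hR, map_sum]; exact sum_nonneg fun j _ => by rw [map_pow]; exact sq_nonneg _
  -- on the zero set of `R` in the simplex, `Q > 0`
  have hQpos : ∀ y ∈ stdSimplex ℝ J, eval y R = 0 → 0 < eval y Q := by
    rintro y ⟨hy0, -⟩ hRy
    have hsq : ∀ j, eval y (X j - aeval g (f j)) = 0 := by
      have h : ∑ j, eval y (X j - aeval g (f j)) ^ 2 = 0 := by
        rw [hR, map_sum] at hRy; simpa only [map_pow] using hRy
      intro j
      have hj := (sum_eq_zero_iff_of_nonneg fun j _ =>
        sq_nonneg (eval y (X j - aeval g (f j)))).mp h j (mem_univ j)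
      exact (pow_eq_zero_iff two_ne_zero).mp hj
    rw [hQ, heval]
    refine hpos _ fun j => ?_
    have h := hsq j
    rw [map_sub, eval_X, heval, sub_eq_zero] at h
    rw [← h]; exact hy0 j
  -- compactness: `Q + c R > 0` on the simplex for some real `c ≥ 0`
  obtain ⟨c, hc⟩ : ∃ c : ℝ, ∀ y ∈ stdSimplex ℝ J, 0 < eval y Q + c * eval y R := by
    have hΔ : IsCompact (stdSimplex ℝ J) := isCompact_stdSimplex ℝ J
    have hQc : Continuous fun y : J → ℝ => eval y Q := continuous_eval Q
    have hRc : Continuous fun y : J → ℝ => eval y R := continuous_eval R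
    set W : Set (J → ℝ) := stdSimplex ℝ J ∩ {y | eval y Q ≤ 0} with hW
    have hWc : IsCompact W := hΔ.inter_right (isClosed_le hQc continuous_const)
    by_cases hWne : W.Nonempty
    · obtain ⟨y₁, hy₁W, hy₁⟩ := hWc.exists_isMinOn hWne hRc.continuousOn
      obtain ⟨y₂, -, hy₂⟩ :=
        hΔ.exists_isMinOn (hWne.mono Set.inter_subset_left) hQc.continuousOn
      have hr : 0 < eval y₁ R := by
        rcases (hR0 y₁).lt_or_eq with h | h
        · exact h
        · exact absurd (hQpos y₁ hy₁W.1 h.symm) (not_lt.mpr hy₁W.2)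
      refine ⟨(|eval y₂ Q| + 1) / eval y₁ R, fun y hy => ?_⟩
      by_cases hyQ : eval y Q ≤ 0
      · have h1 : eval y₁ R ≤ eval y R := hy₁ (show y ∈ W from ⟨hy, hyQ⟩)
        have h2 : eval y₂ Q ≤ eval y Q := hy₂ hy
        have h3 : -|eval y₂ Q| ≤ eval y₂ Q := neg_abs_le _
        have h4 : |eval y₂ Q| + 1 ≤ (|eval y₂ Q| + 1) / eval y₁ R * eval y R := by
          calc |eval y₂ Q| + 1 = (|eval y₂ Q| + 1) / eval y₁ R * eval y₁ R :=
                (div_mul_cancel₀ _ hr.ne').symm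
            _ ≤ (|eval y₂ Q| + 1) / eval y₁ R * eval y R :=
                mul_le_mul_of_nonneg_left h1 (div_nonneg (by positivity) hr.le)
        linarith
      · push Not at hyQ
        have h5 : 0 ≤ (|eval y₂ Q| + 1) / eval y₁ R * eval y R :=
          mul_nonneg (div_nonneg (by positivity) hr.le) (hR0 y)
        linarith
    · refine ⟨0, fun y hy => ?_⟩
      rw [zero_mul, add_zero]
      by_contra h
      exact hWne ⟨y, hy, not_lt.mp h⟩
  -- homogenise `T = Q + c R` with `S`; `aeval f` maps the result to `p`
  set T : MvPolynomial J ℝ := Q + C c * R with hT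
  have hψT : aeval f T = p := by
    rw [hT, map_add, map_mul, hψR, mul_zero, add_zero, hQ]; exact hψg p
  have hTpos : ∀ y ∈ stdSimplex ℝ J, 0 < eval y T := fun y hy => by
    rw [hT, map_add, map_mul, eval_C]; exact hc y hy
  set F : MvPolynomial J ℝ := ∑ k ∈ range (T.totalDegree + 1),
    homogeneousComponent k T * S ^ (T.totalDegree - k) with hF
  have hFhom : F.IsHomogeneous T.totalDegree := by
    rw [hF]
    refine IsHomogeneous.sum _ _ _ fun k hk => ?_
    have hk' : k ≤ T.totalDegree := Nat.lt_succ_iff.mp (mem_range.mp hk)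
    have h := (homogeneousComponent_isHomogeneous k T).mul (hShom.pow (T.totalDegree - k))
    rwa [one_mul, Nat.add_sub_cancel' hk'] at h
  have hψF : aeval f F = p := by
    rw [hF, map_sum]
    simp_rw [map_mul, map_pow, hψS, one_pow, mul_one]
    rw [← map_sum, sum_homogeneousComponent, hψT]
  have hFpos : ∀ y ∈ stdSimplex ℝ J, 0 < eval y F := fun y hy => by
    have hyS : eval y S = 1 := by rw [hS, map_sum]; simpa using hy.2
    have hyF : eval y F = eval y T := by
      rw [hF, map_sum]
      simp_rw [map_mul, map_pow, hyS, one_pow, mul_one]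
      rw [← map_sum, sum_homogeneousComponent]
    rw [hyF]; exact hTpos y hy
  -- Pólya's theorem for `F`, and the substitution `y_j ↦ f_j`
  obtain ⟨N₀, hN₀⟩ := polya F hFhom hFpos
  refine ⟨N₀ + T.totalDegree, fun D hD => ?_⟩
  obtain ⟨N, rfl⟩ : ∃ N, D = N + T.totalDegree := ⟨D - T.totalDegree, by omega⟩
  have hN : N₀ ≤ N := by omega
  set G : MvPolynomial J ℝ := S ^ N * F with hG
  have hGhom : G.IsHomogeneous (N + T.totalDegree) := by
    simpa using (hShom.pow N).mul hFhom
  have hψG : aeval f G = p := by rw [hG, map_mul, map_pow, hψS, one_pow, one_mul, hψF]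
  have hsupp : G.support ⊆ (univ : Finset J).finsuppAntidiag (N + T.totalDegree) :=
    fun β hβ => by
      rw [mem_finsuppAntidiag]
      refine ⟨?_, subset_univ _⟩
      rw [← Finsupp.degree_eq_sum, Finsupp.degree_apply]
      exact (hGhom.degree_eq_sum_deg_support hβ).symm
  refine ⟨fun β => coeff β G, fun β hβ => hN₀ N hN β hβ, ?_⟩
  conv_lhs => rw [← hψG, G.as_sum, map_sum]
  rw [sum_subset hsupp fun β _ hβ => by rw [notMem_support_iff.mp hβ, monomial_zero, map_zero]]
  refine sum_congr rfl fun β _ => ?_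
  rw [aeval_monomial, algebraMap_eq, Finsupp.prod_fintype _ _ fun _ => pow_zero _]

/-- **Handelman's theorem for the unit cube, by degree** [cite: Scheiderer2008, Thm 2.2.5]
[cite: Handelman1988, Thm (Scheiderer 2.2.5)]: if a real polynomial `p` in `n ≥ 1` variables is
strictly positive on the cube `[0, 1]^n`, then for every sufficiently large `D`,
`p = ∑_{|β| = D} c_β ∏_i x_i^{β(inl i)} (1 - x_i)^{β(inr i)}` with *all* `c_β > 0`: a positive
combination of all the degree-`D` products of the `2n` facet polynomials `x_i`, `1 - x_i` of the
cube (`handelman_of_sum_eq_one` for the generators `x_i / n`, `(1 - x_i) / n`, which sum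
to `1`). -/
theorem handelman_cube_degree {ι : Type*} [Fintype ι] [DecidableEq ι] [Nonempty ι]
    (p : MvPolynomial ι ℝ)
    (hpos : ∀ x : ι → ℝ, (∀ i, 0 ≤ x i) → (∀ i, x i ≤ 1) → 0 < eval x p) :
    ∃ D₀ : ℕ, ∀ D : ℕ, D₀ ≤ D → ∃ c : (ι ⊕ ι →₀ ℕ) → ℝ,
      (∀ β : ι ⊕ ι →₀ ℕ, β.degree = D → 0 < c β) ∧
      p = ∑ β ∈ (univ : Finset (ι ⊕ ι)).finsuppAntidiag D,
        C (c β) * ((∏ i, X i ^ β (Sum.inl i)) * ∏ i, (1 - X i) ^ β (Sum.inr i)) := by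
  classical
  set n : ℝ := (Fintype.card ι : ℝ) with hn
  have hnpos : 0 < n := by rw [hn]; exact_mod_cast Fintype.card_pos
  have hn0 : n ≠ 0 := hnpos.ne'
  -- the generators `x_i / n` and `(1 - x_i) / n` sum to `1` and generate `ℝ[x]`
  set f : ι ⊕ ι → MvPolynomial ι ℝ :=
    Sum.elim (fun i => C n⁻¹ * X i) (fun i => C n⁻¹ * (1 - X i)) with hf
  have hsum : ∑ j, f j = 1 := by
    have h1 : ∀ i, f (Sum.inl i) + f (Sum.inr i) = C n⁻¹ := fun i => by
      simp only [hf, Sum.elim_inl, Sum.elim_inr]; ring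
    rw [Fintype.sum_sum_type, ← sum_add_distrib, sum_congr rfl fun i _ => h1 i, sum_const,
      card_univ, ← map_nsmul, nsmul_eq_mul, ← hn, mul_inv_cancel₀ hn0, C_1]
  set g : ι → MvPolynomial (ι ⊕ ι) ℝ := fun i => C n * X (Sum.inl i) with hg_def
  have hg : ∀ i, aeval f (g i) = X i := fun i => by
    simp only [hg_def, map_mul, aeval_C, algebraMap_eq, aeval_X, hf, Sum.elim_inl]
    rw [← mul_assoc, ← C_mul, mul_inv_cancel₀ hn0, C_1, one_mul]
  have hpos' : ∀ x : ι → ℝ, (∀ j, 0 ≤ eval x (f j)) → 0 < eval x p := fun x hx => by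
    refine hpos x (fun i => ?_) (fun i => ?_)
    · have h := hx (Sum.inl i)
      simp only [hf, Sum.elim_inl, map_mul, eval_C, eval_X] at h
      exact (mul_nonneg_iff_of_pos_left (inv_pos.mpr hnpos)).mp h
    · have h := hx (Sum.inr i)
      simp only [hf, Sum.elim_inr, map_mul, eval_C, map_sub, map_one, eval_X] at h
      exact sub_nonneg.mp ((mul_nonneg_iff_of_pos_left (inv_pos.mpr hnpos)).mp h)
  obtain ⟨D₀, hD₀⟩ := handelman_of_sum_eq_one f hsum g hg p hpos'
  refine ⟨D₀, fun D hD => ?_⟩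
  obtain ⟨c, hc, hp⟩ := hD₀ D hD
  refine ⟨fun β => c β * n⁻¹ ^ D, fun β hβ => mul_pos (hc β hβ) (pow_pos (inv_pos.mpr hnpos) D),
    hp.trans (sum_congr rfl fun β hβ => ?_)⟩
  have hD' : ∑ i, β (Sum.inl i) + ∑ i, β (Sum.inr i) = D := by
    rw [← Fintype.sum_sum_type]; exact (mem_finsuppAntidiag.mp hβ).1
  rw [Fintype.prod_sum_type]
  simp only [hf, Sum.elim_inl, Sum.elim_inr, mul_pow]
  rw [prod_mul_distrib, prod_mul_distrib, prod_pow_eq_pow_sum, prod_pow_eq_pow_sum, ← C_pow,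
    ← C_pow, ← hD', pow_add, C_mul, C_mul]
  ring

end HandelmanGeneral

end Literature.Algebra.Polynomial
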